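import Summits.BirchSwinnertonDyer.Rank1Residual.X10.WeilCupSymmetric
import Summits.BirchSwinnertonDyer.Rank1Residual.X11b.WeilTransport
import Summits.BirchSwinnertonDyer.Rank1Residual.X11b.LevelLiftingLower
import HarnessLib

/-!
# The `E[p]` instance of the N2 parity law, PART V: the Poitou–Tate binder `hPT` ("`Z^⊥ ⊆ Z`")
# from the tree's `SelmerComplement` (Howard 2.1.11 / Milne I 4.10(b)) transported along the Weil
# self-duality of `E[p]`
# (cell `b2b-bsdres`, unit `b2b-bsdres-x10` = N2 class lead, GEN 31; theorems only, no definition, no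
# named fact, nothing booked — glue G4b of `class-closure/N2/P-INSTANCE-ASK-x10g31.md`)

HONEST FRAMING (run/shared/lean/b2b/bsd-rank1-residual/, verbatim in every file): the goal of the
cell is to DELETE the COMBINATION-SHAPED residual classes of the Birch–Swinnerton-Dyer formula for
ALL analytic-rank `≤ 1` elliptic curves over `ℚ` — "full BSD formula for every rank `≤ 1` curve in
class `C`" assembled STRICTLY from published theorems — so that the rank-`≤ 1` remainder becomes
exactly the CONSTRUCTION-SHAPED classes, which are TYPED (missing-input `Prop`s), NOT attempted.
This is not "finishing BSD". Class X10b (= N2) keeps its label CONSTRUCTION-SHAPED (NEEDS `X_A3`,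
referee R82.3 / RESIDUAL-MAP §I N2); this file is a TOOL; no mark / label / tier / count moves.

## What

The binder `hPT` of `X10/ResidualSelmerParityGroupForm.even_add_add_card_groupForm` (KMR, proof of
Thm. 3.9: "`Z^⊥ = Z` by Poitou–Tate global duality", inclusion `⊆`) for the dictionary
`b v x y = inv_v(x ∪_{e,v} y)`: a family `(y_v)_v` of local classes that annihilates `loc_S(c)` for
every `c ∈ H¹(K, E[p])` unramified outside `S` IS `loc_S` of such a class. Source in the tree: the
conjunct `SelmerComplement` of `poitouTate_selmerStructure_duality` (Howard Thm. 2.1.11 (i), element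
form), applied to the Selmer structures `𝓕 = (⊥ on S, H¹_ur off S) ≤ 𝓖 = (⊤ on S, H¹_ur off S)` on
`E[p]`; its hypothesis speaks of `y' ∈ H¹_{𝓕^*}(K, E[p]^D)` and the EVALUATION pairing, which is
moved to the Weil cup product on `H¹(K_v, E[p])` by sub-cell X11b's WEIL TRANSPORT
(`LocBridge.localTatePairingZMod_map_weilDual`, `map_weilDual_map_weilDualInv`,
`Levels.map_mem_unramifiedSubgroup`; `galoisCohomology.res_map_one`), by `UnramifiedOrthogonal`
(`(H¹_ur)^* = H¹_ur(E[p]^D)` off `S`, `E[p]` unramified there: `isUnramifiedAt_torsionGaloisModule`),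
and by the SYMMETRY of the Weil cup product (x10 GEN 31, `WeilCupSymmetric`).

* `hPT_of_selmerComplement` — abstract in the pair `𝓕 ≤ 𝓖` (any structures that are `⊥`/`⊤` on
  `S` and unramified off `S`); conclusion in the tree's words.
* `hPT_groupForm` — the binder shape: for `S ⊇ {v ∣ ∞} ∪ {v ∣ p} ∪ {bad v}`, every `y` with
  `∑_{v ∈ S} b v (loc_v c) (y v) = 0` for all `c` unramified outside `S` is `(loc_v c)_{v ∈ S}` for
  such a `c`. ("Unramified outside `S`" is phrased with `unramifiedSubgroup` at the finite `v ∉ S`;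
  for `Λ = residualSelmerStructure W p` of `X10/ResidualSelmerGroup` this is the same condition, as
  `S` contains the places above `p` and the archimedean ones.)

Displayed inputs: `e` a Weil pairing on `E[p]` (biadditive, `μ_p`-valued, equivariant, skew
`e(T,S) = e(S,T)⁻¹`, non-degenerate); `inv` with `UnramifiedOrthogonal` and `SelmerComplement` (two
conjuncts of the ONE named fact, taken by the consumer).

## References

* [Howard2004HeegnerKolyvagin] B. Howard, Compositio 140 (2004), Thm. 2.1.11.
* [MilneADT2006] J. S. Milne, *ADT*, I Thm. 4.10(b), Thm. 2.6, §6 proof of Prop. 6.9.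
* [KlagsbrunMazurRubin2013] Thm. 3.9 (proof: "`Z^⊥ = Z`").
* HOME/class-closure/N2/P-INSTANCE-ASK-x10g31.md (G4b); HOME/X10-AUDIT.md §37.
-/

set_option autoImplicit false

noncomputable section

open scoped Classical

open Function WeierstrassCurve Field Literature.NumberTheory.EllipticCurves
  Literature.NumberTheory.GaloisRepresentations Literature.NumberTheory.GaloisCohomology NumberField
  IsDedekindDomain
open Literature.NumberTheory.GaloisRepresentations.DiscreteGaloisModule (mu unramifiedSubgroup
  SelmerStructure localTatePairingZMod tateDual)
open Summit.BirchSwinnertonDyer.Rank1Residual.X11b.LocBridge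
open Summit.BirchSwinnertonDyer.Rank1Residual.X11b.Levels
open Summit.BirchSwinnertonDyer.Rank1Residual.X11b.AcSelmer
open Summit.BirchSwinnertonDyer.Rank1Residual.X10.WeilCupSymmetric

namespace Summit.BirchSwinnertonDyer.Rank1Residual.X10.ResidualSelmerPoitouTate

-- Cup products need `LocallyCompactSpace Γ_{K_v}` (in the tree a LOCAL instance,
-- `absoluteGaloisGroup_compactSpace`); as in team n1011's files it is an instance HYPOTHESIS here.

variable {K : Type} [Field K] [NumberField K] (W : WeierstrassCurve K) (p : ℕ) [Fact p.Prime] [W.IsElliptic]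
variable (e : geomTorsion W p → geomTorsion W p → AlgebraicClosure K)
  (hμ : ∀ S T, e S T ^ p = 1)
  (hadd₁ : ∀ S₁ S₂ T, e (S₁ + S₂) T = e S₁ T * e S₂ T)
  (hadd₂ : ∀ S T₁ T₂, e S (T₁ + T₂) = e S T₁ * e S T₂)
  (hgal : ∀ (σ : absoluteGaloisGroup K) (S T : geomTorsion W p), σ • e S T = e (σ • S) (σ • T))

/-- **`hPT` from `SelmerComplement`, abstract in `𝓕 ≤ 𝓖`.** Let `𝓕 ≤ 𝓖` be Selmer structures on
`E[p]` with `𝓕_v = ⊥`, `𝓖_v = ⊤` for `v ∈ S` and both unramified outside `S`, where `S` contains the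
archimedean places, the places above `p` and the bad places. If `inv` satisfies `UnramifiedOrthogonal`
and `SelmerComplement`, `e` is skew and non-degenerate, and `b v = inv_v(· ∪_{e,v} ·)`: every family
`y` with `∑_{v ∈ S} b v (loc_v c) (y v) = 0` for all `c ∈ H¹_𝓖(K, E[p])` is `(loc_v c)_{v ∈ S}` for
some `c ∈ H¹_𝓖(K, E[p])`. [cite: Howard2004HeegnerKolyvagin, Thm. 2.1.11 (arXiv:1202.6340 p. 6)]
[cite: MilneADT2006, Ch. I, Thm. 4.10(b)] -/
theorem hPT_of_selmerComplement [∀ v : Place K, LocallyCompactSpace (absoluteGaloisGroup (Place.Completion v))]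
    (hskew : ∀ S T, e T S = (e S T)⁻¹) (hnondeg : ∀ T, (∀ S, e S T = 1) → T = 0)
    (inv : LocalInvariants K p) (hUO : inv.UnramifiedOrthogonal) (hSC : inv.SelmerComplement)
    (b : ∀ v : Place K, galoisCohomology ((W.torsionGaloisModule p).toLocal v) 1 →+
        galoisCohomology ((W.torsionGaloisModule p).toLocal v) 1 →+ ZMod p)
    (hb : ∀ v x y, b v x y = inv v ((weilContPairingLocal W p e hμ hadd₁ hadd₂ hgal v).cupProduct x y))
    {S : Finset (Place K)} (hS : ∀ w : InfinitePlace K, (Sum.inl w : Place K) ∈ S)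
    (hSp : ∀ v : HeightOneSpectrum (𝓞 K), (p : 𝓞 K) ∈ v.asIdeal → (Sum.inr v : Place K) ∈ S)
    (hSbad : ∀ v : HeightOneSpectrum (𝓞 K), (Sum.inr v : Place K) ∉ S → W.HasGoodReductionAt v)
    (𝓕 𝓖 : SelmerStructure (W.torsionGaloisModule (p : ℤ))) (hle : 𝓕 ≤ 𝓖)
    (h𝓕S : ∀ v ∈ S, 𝓕 v = ⊥) (h𝓖S : ∀ v ∈ S, 𝓖 v = ⊤)
    (h𝓕 : 𝓕.IsUnramifiedOutside S) (h𝓖 : 𝓖.IsUnramifiedOutside S)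
    (y : ∀ v : Place K, galoisCohomology ((W.torsionGaloisModule p).toLocal v) 1)
    (hy : ∀ c : galoisCohomology (W.torsionGaloisModule (p : ℤ)) 1, c ∈ 𝓖.selmerGroup →
      ∑ v ∈ S, b v (galoisCohomology.localization (W.torsionGaloisModule p) v 1 c) (y v) = 0) :
    ∃ c : galoisCohomology (W.torsionGaloisModule (p : ℤ)) 1, c ∈ 𝓖.selmerGroup ∧
      ∀ v ∈ S, galoisCohomology.localization (W.torsionGaloisModule p) v 1 c = y v := by
  haveI : Finite (geomTorsion W (p : ℤ)) := finite_geomTorsion_of_neZero W p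
  have hM : ∀ m : geomTorsion W (p : ℤ), p • m = 0 := fun m => AddSubgroup.torsionBy.nsmul m
  have hSout : ∀ v : HeightOneSpectrum (𝓞 K), (Sum.inr v : Place K) ∉ S →
      ((p : ℕ) : 𝓞 K) ∉ v.asIdeal ∧ GaloisRep.IsUnramifiedAt v (W.torsionGaloisModule (p : ℤ)) :=
    fun v hv => ⟨fun h => hv (hSp v h), isUnramifiedAt_torsionGaloisModule W (hSbad v hv)
      (by rw [Int.cast_natCast]; exact fun h => hv (hSp v h))⟩
  -- the annihilation hypothesis of `SelmerComplement` (i), from `hy` through the Weil transport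
  have hann : ∀ y' ∈ (inv.dualSelmerStructure (W.torsionGaloisModule (p : ℤ)) 𝓕).selmerGroup,
      ∑ v ∈ S, localTatePairingZMod (W.torsionGaloisModule (p : ℤ)) p v (inv v) (y v)
        (galoisCohomology.localization ((W.torsionGaloisModule (p : ℤ)).tateDual p) v 1 y') = 0 := by
    intro y' hy'
    -- `y' = w_* c` with `c = w⁻¹_* y'`
    set c : galoisCohomology (W.torsionGaloisModule (p : ℤ)) 1 :=
      galoisCohomology.map (weilDualInv W p e hμ hadd₁ hadd₂ hgal hnondeg) 1 y' with hc_def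
    have hyc : galoisCohomology.map (weilDualIntertwining W p e hμ hadd₁ hadd₂ hgal) 1 c = y' :=
      map_weilDual_map_weilDualInv W p e hμ hadd₁ hadd₂ hgal hnondeg y'
    -- `c` lies in `H¹_𝓖`: on `S` no condition; off `S` unramified, from `y'_v ∈ (H¹_ur)^* = H¹_ur(E[p]^D)`
    have hy'sel := (SelmerStructure.mem_selmerGroup_iff _ y').mp hy'
    have hc𝓖 : c ∈ 𝓖.selmerGroup := by
      rw [SelmerStructure.mem_selmerGroup_iff]
      intro v'
      rcases v' with w | v
      · rw [h𝓖S _ (hS w)]; trivial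
      · by_cases hv : (Sum.inr v : Place K) ∈ S
        · rw [h𝓖S _ hv]; trivial
        · rw [h𝓖.2 v hv]
          have hdual : galoisCohomology.localization ((W.torsionGaloisModule (p : ℤ)).tateDual p) (Sum.inr v) 1 y' ∈
              unramifiedSubgroup (GaloisRep.toLocal v ((W.torsionGaloisModule (p : ℤ)).tateDual p)) 1 := by
            have h := hy'sel (Sum.inr v)
            rw [LocalInvariants.dualSelmerStructure_apply, h𝓕.2 v hv,
              (hUO (W.torsionGaloisModule (p : ℤ)) hM v (hSout v hv).1 (hSout v hv).2).1] at h
            exact h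
          have hloc : galoisCohomology.localization (W.torsionGaloisModule (p : ℤ)) (Sum.inr v) 1 c =
              galoisCohomology.map ((weilDualInv W p e hμ hadd₁ hadd₂ hgal hnondeg).restrictField
                (Place.Completion (Sum.inr v : Place K))) 1
                (galoisCohomology.localization ((W.torsionGaloisModule (p : ℤ)).tateDual p) (Sum.inr v) 1 y') :=
            galoisCohomology.res_map_one _ _ y'
          rw [hloc]
          exact map_mem_unramifiedSubgroup
            (ρ₁ := GaloisRep.toLocal v ((W.torsionGaloisModule (p : ℤ)).tateDual p))
            (ρ₂ := GaloisRep.toLocal v (W.torsionGaloisModule (p : ℤ))) _ hdual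
    -- the sum of local Tate terms is the sum of the `b v`
    rw [← hy c hc𝓖]
    refine Finset.sum_congr rfl fun v _ => ?_
    rw [← hyc, show galoisCohomology.localization ((W.torsionGaloisModule (p : ℤ)).tateDual p) v 1
        (galoisCohomology.map (weilDualIntertwining W p e hμ hadd₁ hadd₂ hgal) 1 c) =
      galoisCohomology.map ((weilDualIntertwining W p e hμ hadd₁ hadd₂ hgal).restrictField
        (Place.Completion v)) 1 (galoisCohomology.localization (W.torsionGaloisModule (p : ℤ)) v 1 c) from
      galoisCohomology.res_map_one _ _ c,
      localTatePairingZMod_map_weilDual, hb]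
    exact congrArg (inv v) (weilCupLocal_symm W p e hμ hadd₁ hadd₂ hgal hskew v _ _)
  obtain ⟨x, hx𝓖, hxS⟩ := (hSC (W.torsionGaloisModule (p : ℤ)) hM S hSout 𝓕 𝓖 hle h𝓕 h𝓖).1 y
    (fun v hv => by rw [h𝓖S v hv]; trivial) hann
  refine ⟨x, hx𝓖, fun v hv => ?_⟩
  have h := hxS v hv
  rw [h𝓕S v hv, AddSubgroup.mem_bot, sub_eq_zero] at h
  exact h

/-- **`hPT` — the Poitou–Tate binder of the group-currency law, discharged.** For
`S ⊇ {v ∣ ∞} ∪ {v ∣ p} ∪ {bad v}`, `b v = inv_v(· ∪_{e,v} ·)` with `inv` satisfying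
`UnramifiedOrthogonal ∧ SelmerComplement` (conjuncts of `poitouTate_selmerStructure_duality`) and `e`
skew and non-degenerate: if `∑_{v ∈ S} b v (loc_v c) (y v) = 0` for every `c ∈ H¹(K, E[p])` unramified
at all finite `v ∉ S`, then `y v = loc_v c` on `S` for such a `c`.
[cite: Howard2004HeegnerKolyvagin, Thm. 2.1.11 (arXiv:1202.6340 p. 6)] [cite: KlagsbrunMazurRubin2013, Thm. 3.9 (proof)] -/
theorem hPT_groupForm [∀ v : Place K, LocallyCompactSpace (absoluteGaloisGroup (Place.Completion v))]
    (hskew : ∀ S T, e T S = (e S T)⁻¹) (hnondeg : ∀ T, (∀ S, e S T = 1) → T = 0)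
    (inv : LocalInvariants K p) (hUO : inv.UnramifiedOrthogonal) (hSC : inv.SelmerComplement)
    (b : ∀ v : Place K, galoisCohomology ((W.torsionGaloisModule p).toLocal v) 1 →+
        galoisCohomology ((W.torsionGaloisModule p).toLocal v) 1 →+ ZMod p)
    (hb : ∀ v x y, b v x y = inv v ((weilContPairingLocal W p e hμ hadd₁ hadd₂ hgal v).cupProduct x y))
    {S : Finset (Place K)} (hS : ∀ w : InfinitePlace K, (Sum.inl w : Place K) ∈ S)
    (hSp : ∀ v : HeightOneSpectrum (𝓞 K), (p : 𝓞 K) ∈ v.asIdeal → (Sum.inr v : Place K) ∈ S)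
    (hSbad : ∀ v : HeightOneSpectrum (𝓞 K), (Sum.inr v : Place K) ∉ S → W.HasGoodReductionAt v)
    (y : ∀ v : Place K, galoisCohomology ((W.torsionGaloisModule p).toLocal v) 1)
    (hy : ∀ c : galoisCohomology (W.torsionGaloisModule (p : ℤ)) 1,
      (∀ v : HeightOneSpectrum (𝓞 K), (Sum.inr v : Place K) ∉ S →
        galoisCohomology.localization (W.torsionGaloisModule p) (Sum.inr v) 1 c ∈
          unramifiedSubgroup (GaloisRep.toLocal v (W.torsionGaloisModule (p : ℤ))) 1) →
      ∑ v ∈ S, b v (galoisCohomology.localization (W.torsionGaloisModule p) v 1 c) (y v) = 0) :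
    ∃ c : galoisCohomology (W.torsionGaloisModule (p : ℤ)) 1,
      (∀ v : HeightOneSpectrum (𝓞 K), (Sum.inr v : Place K) ∉ S →
        galoisCohomology.localization (W.torsionGaloisModule p) (Sum.inr v) 1 c ∈
          unramifiedSubgroup (GaloisRep.toLocal v (W.torsionGaloisModule (p : ℤ))) 1) ∧
      ∀ v ∈ S, galoisCohomology.localization (W.torsionGaloisModule p) v 1 c = y v := by
  -- the structures `𝓕 = (⊥ on S, H¹_ur off S) ≤ 𝓖 = (⊤ on S, H¹_ur off S)`
  let U : SelmerStructure (W.torsionGaloisModule (p : ℤ)) := fun v =>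
    match v with
    | Sum.inl _ => ⊤
    | Sum.inr v => unramifiedSubgroup (GaloisRep.toLocal v (W.torsionGaloisModule (p : ℤ))) 1
  have hU : ∀ v : HeightOneSpectrum (𝓞 K),
      U (Sum.inr v) = unramifiedSubgroup (GaloisRep.toLocal v (W.torsionGaloisModule (p : ℤ))) 1 :=
    fun v => rfl
  obtain ⟨c, hc𝓖, hcS⟩ := hPT_of_selmerComplement W p e hμ hadd₁ hadd₂ hgal hskew hnondeg inv hUO hSC b hb
    hS hSp hSbad (fun v => if v ∈ S then ⊥ else U v) (fun v => if v ∈ S then ⊤ else U v)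
    (fun v => by
      by_cases hv : v ∈ S
      · simp only [if_pos hv]; exact bot_le
      · simp only [if_neg hv]; exact le_rfl)
    (fun v hv => if_pos hv) (fun v hv => if_pos hv)
    ⟨hS, fun v hv => by simp only [if_neg hv, hU]⟩ ⟨hS, fun v hv => by simp only [if_neg hv, hU]⟩ y
    (fun c hc => hy c fun v hv => by
      have h := (SelmerStructure.mem_selmerGroup_iff _ c).mp hc (Sum.inr v)
      simp only [if_neg hv, hU] at h
      exact h)
  refine ⟨c, fun v hv => ?_, hcS⟩
  have h := (SelmerStructure.mem_selmerGroup_iff _ c).mp hc𝓖 (Sum.inr v)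
  simp only [if_neg hv, hU] at h
  exact h

end Summit.BirchSwinnertonDyer.Rank1Residual.X10.ResidualSelmerPoitouTate

end
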